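import Mathlib
import Summits.ValiantsHypothesis.ValiantsHypothesis.Theorems.BarrierLeverPartitionMinorsHitByVPHiddenStatesTwoLayerWitness

/-!
# Route BarrierLever — item `PartitionMinorsHitByVP` (stmt-ValiantsHypothesis-19717), line `hidden_states`:
# THE ANTIPODAL TABLE FOR GENERAL ROWS — complete balls serve every down-set containing a punctured ball, up to one disjointness minor

Helper file (`--supports stmt-ValiantsHypothesis-19717`; cell valiant-natproofs, rung V4, 𝒟-side door (c), line
`Cruxes/PartitionMinorsHitByVP/Lines/hidden_states.lean` v9; prover seat val-np-p3 gen 18). Definition-free. Closes NO item.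
Generalises `SymbJoin.symGood_halfBall_cube` (p590044, val-np-p6 g8: the half ball `B_t(2t+1)` serves the FULL `2t`-cube) from the full cube
to ARBITRARY row families, in the one-cube / `K = h` form of the line's node «complete balls» (CB-lower, `BallGood h h |B_s(h)|`).

THE TABLE. States = coordinates (`K = h`), base point `0`, state `q ≠ c ↦ e_q`, the apex state `c ↦ −𝟙` (all coordinates `−1`). Then a
column `J ∌ c` (`|J| ≤ s`) sits at the indicator point `1_J` and reads `[U ⊆ J]` on the row `U`; a column `J ∋ c` sits at `1_{J∖c} − 𝟙` and
reads `(−1)^{|U|}·[U ∩ (J ∖ c) = ∅]` (`antipodalAt_entry_pure / _deep`; the table is built inside the proof, no definition).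

THE CRITERION (`exists_table_of_antipodalRows`). Let the rows `u` (injective, ANY family — no lower-set hypothesis) contain the punctured
ball `{S : c ∉ S, |S| ≤ s}` (H1) and let the columns `J` be injective with `|J k| ≤ s` (any sub-family of the ball `B_s([h])`, e.g. the whole
ball when `r = |B_s(h)|`). Rows split into 𝒜 = the punctured-ball rows and 𝒳 = the rest (`c ∈ U` or `|U| > s`); pure columns VANISH on 𝒳,
so the matrix is block-triangular and nonsingular as soon as (H3) the deep columns restricted to 𝒳 — the 0/1 DISJOINTNESS pattern
`[U ∩ (J∖c) = ∅]`, `U ∈ 𝒳`, `c ∈ J` — are linearly independent; the pure block is the zeta matrix of the punctured ball on its copy rows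
(`TwoLayer.eq_zero_of_zeta`). So: (H1) + (H3) ⇒ some table makes the block-additive matrix nonsingular. For the full `2t`-cube (rows avoid
`c`, 𝒳 = the sets of size `≥ t+1`, disjointness with the `(≤ t−1)`-sets = inclusion into complements) (H3) is the unitriangular pattern of
p590044; the criterion also covers e.g. the down-sets `B_s([h]) ∖ {c ∪ W : W ∈ 𝒲} ∪ {W ∪ A : W ∈ 𝒲}` (𝒲 any family of `(s−1)`-subsets of
`[h] ∖ (c ∪ A)`, `|A| = 2`: 𝒳-rows `c ∪ Y` (`Y ∉ 𝒲`) and `W ∪ A`, whose disjointness pattern against `B_{s−1}([h]∖c)` factors as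
«inclusion × Möbius» with an identity block on 𝒲) — an exponential-size perturbation class of the ball at every `(h, s)`.

CENSUS / HONESTY (seat lab/antipodal_test.py): the criterion is EXACT for this table (criterion ⟺ det ≠ 0 in 240/240 random eligible down-sets,
h ≤ 7) but the table is WEAK as a universal device: most random down-sets containing a punctured ball fail (H3) at h ≥ 6 although they are
good for a generic table (26/40 at (6,2), 40/40 at (8,3)); a generic vector in place of `−𝟙` has exactly the same power. So this is a door
for structured perturbations of balls, not a route to CB-lower.

WHAT THIS IS NOT: no universality claim; item 19717 OPEN; nothing on crux 14610 or VP ≠ VNP.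
-/

set_option linter.dupNamespace false

namespace Summit.ValiantsHypothesis.ValiantsHypothesis.Theorems.BarrierLever.HiddenStates

open Finset Matrix

noncomputable section

namespace Antipodal

variable {h r : ℕ}

/-- The hidden point of the column `J` under the antipodal table at the apex `c` (base `0`, state `q ≠ c ↦ e_q`, state `c ↦ −𝟙`):
coordinate `a` equals `[a ∈ J ∧ a ≠ c] − [c ∈ J]`. -/
theorem antipodalAt_point (c : Fin h) (J : Finset (Fin h)) (a : Fin h) :
    (0 : ℂ) + ∑ q ∈ J, (if q = c then (-1 : ℂ) else if q = a then 1 else 0)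
      = (if a ∈ J ∧ a ≠ c then (1 : ℂ) else 0) - (if c ∈ J then (1 : ℂ) else 0) := by
  classical
  rw [zero_add]
  have hsplit : ∀ q ∈ J, (if q = c then (-1 : ℂ) else if q = a then 1 else 0)
      = (if q = a then (if a ≠ c then (1 : ℂ) else 0) else 0) - (if q = c then (1 : ℂ) else 0) := by
    intro q _
    by_cases hqc : q = c
    · subst hqc
      by_cases hqa : q = a
      · subst hqa; simp
      · simp [hqa]
    · by_cases hqa : q = a
      · subst hqa; simp [hqc]
      · simp [hqc, hqa]
  rw [Finset.sum_congr rfl hsplit, Finset.sum_sub_distrib, Finset.sum_ite_eq' J a, Finset.sum_ite_eq' J c]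
  congr 1
  by_cases ha : a ∈ J <;> by_cases hac : a = c <;> simp [ha, hac]

/-- Entry of a PURE column (`c ∉ J`): the zeta indicator `[U ⊆ J]`. -/
theorem antipodalAt_entry_pure (c : Fin h) (J : Finset (Fin h)) (hJ : c ∉ J) (U : Finset (Fin h)) :
    ∏ a ∈ U, ((0 : ℂ) + ∑ q ∈ J, (if q = c then (-1 : ℂ) else if q = a then 1 else 0)) = if U ⊆ J then 1 else 0 := by
  classical
  simp_rw [antipodalAt_point, if_neg hJ, sub_zero]
  have hiff : ∀ a, (a ∈ J ∧ a ≠ c) ↔ a ∈ J := fun a => ⟨fun h' => h'.1, fun h' => ⟨h', fun hac => hJ (hac ▸ h')⟩⟩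
  simp_rw [hiff]
  by_cases hsub : U ⊆ J
  · rw [if_pos hsub]
    exact Finset.prod_eq_one fun a ha => if_pos (hsub ha)
  · rw [if_neg hsub]
    obtain ⟨a, haU, haJ⟩ := Finset.not_subset.mp hsub
    exact Finset.prod_eq_zero haU (if_neg haJ)

/-- Entry of a DEEP column (`c ∈ J`): `(−1)^{|U|} · [U ∩ (J ∖ c) = ∅]`. -/
theorem antipodalAt_entry_deep (c : Fin h) (J : Finset (Fin h)) (hJ : c ∈ J) (U : Finset (Fin h)) :
    ∏ a ∈ U, ((0 : ℂ) + ∑ q ∈ J, (if q = c then (-1 : ℂ) else if q = a then 1 else 0))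
      = (-1) ^ U.card * (if Disjoint U (J.erase c) then 1 else 0) := by
  classical
  simp_rw [antipodalAt_point, if_pos hJ]
  have hval : ∀ a, ((if a ∈ J ∧ a ≠ c then (1 : ℂ) else 0) - 1) = if a ∈ J.erase c then 0 else -1 := by
    intro a
    by_cases h1 : a ∈ J ∧ a ≠ c
    · have h2 : a ∈ J.erase c := Finset.mem_erase.mpr ⟨h1.2, h1.1⟩
      rw [if_pos h1, if_pos h2]; ring
    · have h2 : a ∉ J.erase c := fun h2 => h1 ⟨(Finset.mem_erase.mp h2).2, (Finset.mem_erase.mp h2).1⟩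
      rw [if_neg h1, if_neg h2]; ring
  rw [Finset.prod_congr rfl (fun a _ => hval a)]
  by_cases hd : Disjoint U (J.erase c)
  · rw [if_pos hd, mul_one]
    rw [Finset.prod_congr rfl (fun a ha => by rw [if_neg (Finset.disjoint_left.mp hd ha)]), Finset.prod_const]
  · rw [if_neg hd, mul_zero]
    obtain ⟨a, haU, haJ⟩ := Finset.not_disjoint_iff.mp hd
    exact Finset.prod_eq_zero haU (if_pos haJ)

/-- **THE ANTIPODAL TABLE FOR GENERAL ROWS.** Rows `u` (any family) containing the punctured ball `{S : c ∉ S, |S| ≤ s}` (H1); columns `J`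
injective of cardinality `≤ s` (a sub-family of the ball `B_s([h])`, e.g. all of it). If the deep columns (`c ∈ J k`) restricted to the rows
OUTSIDE the punctured ball, read through the disjointness pattern `[u i ∩ (J k ∖ c) = ∅]`, are linearly independent (H3), then the antipodal
table makes the one-cube block-additive matrix (`K = h`, states = coordinates) nonsingular. -/
theorem exists_table_of_antipodalRows (s : ℕ) (c : Fin h) (u : Fin r → Finset (Fin h))
    (J : Fin r → Finset (Fin h)) (hJ : Function.Injective J) (hcard : ∀ k, (J k).card ≤ s)
    (hball : ∀ S : Finset (Fin h), c ∉ S → S.card ≤ s → ∃ i, u i = S)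
    (hdeep : LinearIndependent ℂ (fun k : {k : Fin r // c ∈ J k} =>
        fun i : {i : Fin r // ¬ (c ∉ u i ∧ (u i).card ≤ s)} =>
          (if Disjoint (u i.1) ((J k.1).erase c) then (1 : ℂ) else 0))) :
    ∃ tx : Option (Fin h) → Fin h → ℂ,
      (Matrix.of fun i k : Fin r => ∏ a ∈ u i, (tx none a + ∑ q ∈ J k, tx (some q) a)).det ≠ 0 := by
  classical
  -- the antipodal table at the apex `c`: base `0`, state `q ≠ c ↦ e_q`, state `c ↦ −𝟙`
  let tx : Option (Fin h) → Fin h → ℂ := fun o a =>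
    match o with
    | none => 0
    | some q => if q = c then -1 else if q = a then 1 else 0
  refine ⟨tx, ?_⟩
  -- the columns
  let col : Fin r → (Fin r → ℂ) := fun k i => ∏ a ∈ u i, (tx none a + ∑ q ∈ J k, tx (some q) a)
  have hcol : ∀ k i, col k i = ∏ a ∈ u i, ((0 : ℂ) + ∑ q ∈ J k, (if q = c then (-1 : ℂ) else if q = a then 1 else 0)) :=
    fun k i => rfl
  have hpure : ∀ k i, c ∉ J k → col k i = if u i ⊆ J k then 1 else 0 :=
    fun k i hk => by rw [hcol, antipodalAt_entry_pure c (J k) hk (u i)]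
  have hdeepcol : ∀ k i, c ∈ J k → col k i = (-1) ^ (u i).card * (if Disjoint (u i) ((J k).erase c) then 1 else 0) :=
    fun k i hk => by rw [hcol, antipodalAt_entry_deep c (J k) hk (u i)]
  -- a pure column vanishes outside the punctured ball
  have hpure_out : ∀ k i, c ∉ J k → ¬ (c ∉ u i ∧ (u i).card ≤ s) → col k i = 0 := by
    intro k i hk hi
    rw [hpure k i hk, if_neg]
    intro hsub
    apply hi
    exact ⟨fun hc => hk (hsub hc), (Finset.card_le_card hsub).trans (hcard k)⟩
  -- suppose the matrix is singular
  intro hdet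
  obtain ⟨α, hαne, hαmul⟩ := Matrix.exists_mulVec_eq_zero_iff.mpr hdet
  apply hαne
  have hrow : ∀ i, ∑ k, α k * col k i = 0 := by
    intro i
    have := congrFun hαmul i
    rw [Matrix.mulVec, dotProduct] at this
    simpa [Matrix.of_apply, col, mul_comm] using this
  have hsum : ∑ k, α k • col k = 0 := by
    funext i
    rw [Finset.sum_apply, Pi.zero_apply]
    simpa [Pi.smul_apply, smul_eq_mul] using hrow i
  -- PHASE A: deep coefficients vanish (hypothesis H3 on the rows outside the punctured ball)
  have hdeepzero : ∀ k, c ∈ J k → α k = 0 := by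
    -- the relation restricted to the outside rows involves deep columns only
    have hrel : ∑ kd : {k : Fin r // c ∈ J k}, α kd.1 •
        (fun i : {i : Fin r // ¬ (c ∉ u i ∧ (u i).card ≤ s)} =>
          (if Disjoint (u i.1) ((J kd.1).erase c) then (1 : ℂ) else 0)) = 0 := by
      funext i
      rw [Finset.sum_apply, Pi.zero_apply]
      simp only [Pi.smul_apply, smul_eq_mul]
      have h0 := hrow i.1
      -- split the full sum into deep and pure columns; pure ones vanish at the outside row i
      have hsplit : ∑ k, α k * col k i.1 =
          ∑ k ∈ Finset.univ.filter (fun k => c ∈ J k), α k * col k i.1 := by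
        rw [← Finset.sum_filter_add_sum_filter_not Finset.univ (fun k => c ∈ J k)]
        have hz : ∑ k ∈ Finset.univ.filter (fun k => ¬ c ∈ J k), α k * col k i.1 = 0 :=
          Finset.sum_eq_zero fun k hk => by
            rw [Finset.mem_filter] at hk
            rw [hpure_out k i.1 hk.2 i.2, mul_zero]
        rw [hz, add_zero]
      rw [hsplit] at h0
      -- rewrite deep entries and pull out the common row sign
      have h1 : ∑ k ∈ Finset.univ.filter (fun k => c ∈ J k), α k * col k i.1 =
          (-1) ^ (u i.1).card * ∑ k ∈ Finset.univ.filter (fun k => c ∈ J k),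
            α k * (if Disjoint (u i.1) ((J k).erase c) then (1 : ℂ) else 0) := by
        rw [Finset.mul_sum]
        refine Finset.sum_congr rfl fun k hk => ?_
        rw [Finset.mem_filter] at hk
        rw [hdeepcol k i.1 hk.2]
        ring
      rw [h1] at h0
      have h2 : ∑ k ∈ Finset.univ.filter (fun k => c ∈ J k),
          α k * (if Disjoint (u i.1) ((J k).erase c) then (1 : ℂ) else 0) = 0 := by
        rcases mul_eq_zero.mp h0 with h' | h'
        · exact absurd h' (pow_ne_zero _ (by norm_num))
        · exact h'
      have h3 := h2
      rw [Finset.sum_subtype (Finset.univ.filter (fun k => c ∈ J k)) (p := fun k => c ∈ J k)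
        (fun k => by simp)] at h3
      simpa using h3
    have := Fintype.linearIndependent_iff.mp hdeep (fun kd => α kd.1) hrel
    intro k hk
    exact this ⟨k, hk⟩
  -- PHASE B: the pure columns form the zeta pattern of the punctured ball on their copy rows
  let A : Finset (Fin r) := Finset.univ.filter fun k => c ∉ J k
  have hrowex : ∀ k, ∃ i, k ∈ A → u i = J k := by
    intro k
    by_cases hk : c ∉ J k
    · obtain ⟨i, hi⟩ := hball (J k) hk (hcard k)
      exact ⟨i, fun _ => hi⟩
    · rcases Nat.eq_zero_or_pos r with hr | hr
      · exact absurd k.2 (by omega)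
      · exact ⟨⟨0, hr⟩, fun hkA => absurd (Finset.mem_filter.mp hkA).2 hk⟩
  choose ρ hρ using hrowex
  have hzeta : ∀ k ∈ A, ∀ k' ∈ A, col k' (ρ k) = if J k ⊆ J k' then 1 else 0 := by
    intro k hk k' hk'
    have hk'c : c ∉ J k' := (Finset.mem_filter.mp hk').2
    rw [hpure k' (ρ k) hk'c, hρ k hk]
  have hαA : ∀ k, k ∉ A → α k = 0 := by
    intro k hk
    have hkc : c ∈ J k := by
      by_contra h'
      exact hk (Finset.mem_filter.mpr ⟨Finset.mem_univ _, h'⟩)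
    exact hdeepzero k hkc
  funext k
  exact TwoLayer.eq_zero_of_zeta J hJ col A ρ hzeta α hαA hsum k

end Antipodal

end

end Summit.ValiantsHypothesis.ValiantsHypothesis.Theorems.BarrierLever.HiddenStates
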